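import Mathlib
import Summits.ResolutionOfSingularities.ResolutionOfSingularities.Theorems.AbhyankarShadowsSemivaluationShadowsHenselOverRuledShadowsRankOneAssembly
import HarnessLib

/-!
# Shadows for Hensel-generated top layers over a ruled skeleton, rational rank one
(`stub_henselOverRuledShadowsRankOne`)

Crux `SemivaluationShadows` (item `stmt-ResolutionOfSingularities-16757`, route
`ResolutionOfSingularities/AbhyankarShadows`, the EXISTENCE half of Teissier's semivaluation
conjecture typed over finite sets), line `birth`, registered stub
`stub_henselOverRuledShadowsRankOne`, PROVED: `henselOverRuledShadowsRankOne` (binder form,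
conclusion `HasShadow O R F`) and
`stub_henselOverRuledShadowsRankOne : Sig.stub_henselOverRuledShadowsRankOne` (the registered
signature by name; `HasShadow` and `Sig.stub_henselOverRuledShadowsRankOne` are copied VERBATIM,
`private`, from the line skeleton `Cruxes/SemivaluationShadows/Lines/birth.lean`, which a
Theorems file cannot import). The proof is `henselOverRuledShadowsRankOne_of`
(`…HenselOverRuledShadowsRankOneAssembly.lean`) with `M = K̄`.

**Statement.** `k` algebraically closed of characteristic `p`, `K/k` finitely generated, `O ∋ k` a
RATIONAL valuation ring of `K` (every element of `O` is a constant modulo `𝔪_O`) of rational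
rank one; `K₀ ⊆ K` an intermediate field on which `ν` is discrete (`0 ≠ t ∈ K₀`, `ν t < 1`, all
values on `K₀ˣ` powers of `ν t`), `v` transcendental over `K₀`, and `K = K₀(v, η)` where
`η ∈ O` is a HENSEL ROOT over `O ∩ K₀(v)`: `h(η) = 0`, `ν(h'(η)) = 1` for a monic `h` with
coefficients in `O ∩ K₀(v)`. Then every finitely generated `R ⊆ O` and finite `F ⊆ R` admit a
SHADOW exact on `F` (all eight clauses of the crux). This covers every `(K, ν)` of rational rank
one whose centre on some model is a regular closed point.

**Proof** (minimal approximants + a transported top layer; see the assembly file). With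
`K₁ = K₀(v)`: every `z ∈ K` is `q_z(η)`; ONE Newton approximant `a ∈ K₁ ∩ O` of `η` serves the
finitely many prescribed `q_z`; the saturation `V` of `ν` on `M = K̄` and a MINIMAL approximant
`ρ'` of `v`, exact on the finitely many fixed elements of `K₁` (coefficients, `a`, `h(a)`,
`h'(a)`, `q_z(a)`) give the evaluation `φ' : K₀[v, T] → M`; `η ↦ ζ :=` the root of `h^φ'` near
`φ'(a)` extends it (`ζ` kills the minimal polynomial of `η` because the cofactor keeps its
value), and `V(Φ z) = ν(q_z(a)) = ν(z)` by the TRANSPORT; the frame is a uniformiser `g_π(ρ')`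
of the cyclic value group of `K₀(ρ')`, lifted exactly to `g_π(v)` by minimality, and it still
generates the values of `K₀(ρ', ζ)` because `ζ` is a Hensel root over `V ∩ K₀(ρ')` (downstairs
Newton); finally the one-element frame transfer.

Classically: minimal pairs / key polynomials (MacLane 1936; Alexandru–Popescu–Zaharescu;
Khanduja) and Newton–Hensel approximation; no named fact is used. [folklore]
-/

set_option linter.dupNamespace false

noncomputable section

open Polynomial

namespace Summit.ResolutionOfSingularities.ResolutionOfSingularities.Theorems

/-! ## The registered stub signature, by name

`HasShadow` and `Sig.stub_henselOverRuledShadowsRankOne` are copied VERBATIM from the line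
skeleton `Cruxes/SemivaluationShadows/Lines/birth.lean`; they are `private` so that sibling stub
files can do the same without name clashes — the statements unfold definitionally to the
skeleton's. -/

/-- VERBATIM copy of the skeleton's `HasShadow O R F` (a predicate of the line skeleton, not a
named fact): the conclusion of the crux `SemivaluationShadows` for one datum — a finite set `F`
of a finitely generated `k`-subalgebra `R` of `K` inside the valuation ring `O`
(`∃ R₁ hle _, R₁.FG ∧ IsFractionRing R₁ K ∧ ∃ L _ _ φ O', …`). -/
private def HasShadow {k K : Type} [Field k] [Field K] [Algebra k K] (O : ValuationSubring K)
    (R : Subalgebra k K) (F : Finset R) : Prop :=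
  ∃ (R₁ : Subalgebra k K) (hle : R ≤ R₁) (_ : R₁.toSubring ≤ O.toSubring), R₁.FG ∧
    IsFractionRing R₁ K ∧ ∃ (L : Type) (_ : Field L) (_ : Algebra k L) (φ : R₁ →ₐ[k] L)
    (O' : ValuationSubring L), Module.finrank ℤ (Additive (O'.ValueGroup)ˣ) =
      Module.finrank ℤ (Additive (O.ValueGroup)ˣ) ∧ (∀ y : R₁, φ y ∈ O') ∧
    (∀ y : R₁, O'.valuation (φ y) < 1 ↔ O.valuation (y : K) < 1) ∧
    (∀ z : L, z ∈ O' → ∃ c : k, O'.valuation (z - algebraMap k L c) < 1) ∧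
    (MonoidHom.mrange (O'.valuation.toMonoidWithZeroHom.toMonoidHom.comp
      φ.toRingHom.toMonoidHom)).FG ∧
    ∃ ι : O'.ValueGroup →*₀o O.ValueGroup, Function.Injective ι ∧
      (∀ y : R₁, φ y ≠ 0 → ∃ y' : R₁, ι (O'.valuation (φ y)) = O.valuation (y' : K)) ∧
      ∀ x ∈ F, ι (O'.valuation (φ (Subalgebra.inclusion hle x))) = O.valuation ((x : R) : K)

/-- VERBATIM copy of the skeleton's registered signature `Sig.stub_henselOverRuledShadowsRankOne`
(the statement of the stub, PROVED below as `stub_henselOverRuledShadowsRankOne` — not a named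
fact): HENSEL-GENERATED top layers over a ruled skeleton, rational rank one. As
`stub_ruledShadowsRankOne`, but `K = K₀(v)(η)` where `η` is a HENSEL ROOT over `O ∩ K₀(v)`:
`h(η) = 0` for a monic `h` with coefficients in `K₀(v) ∩ O` and `ν(h'(η)) = 1`. -/
private def Sig.stub_henselOverRuledShadowsRankOne : Prop :=
  ∀ p : ℕ, p.Prime → ∀ (k K : Type) [Field k] [CharP k p] [IsAlgClosed k] [Field K] [Algebra k K],
    (⊤ : IntermediateField k K).FG → ∀ (O : ValuationSubring K)
    (hk : ∀ c : k, algebraMap k K c ∈ O),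
    (∀ x : K, x ∈ O → ∃ c : k, O.valuation (x - algebraMap k K c) < 1) →
    Module.finrank ℤ (Additive (O.ValueGroup)ˣ) = 1 →
    ∀ (K₀ : IntermediateField k K) (t v η : K) (h : Polynomial K), t ∈ K₀ → t ≠ 0 → O.valuation t < 1 →
    (∀ x : K, x ∈ K₀ → x ≠ 0 → ∃ m : ℤ, O.valuation x = O.valuation t ^ m) →
    Transcendental K₀ v →
    (∀ i : ℕ, h.coeff i ∈ IntermediateField.adjoin K₀ {v} ∧ h.coeff i ∈ O) → h.Monic →
    Polynomial.aeval η h = 0 → O.valuation (Polynomial.aeval η (Polynomial.derivative h)) = 1 → η ∈ O →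
    IntermediateField.adjoin K₀ {v, η} = ⊤ →
    ∀ R : Subalgebra k K, R.FG → R.toSubring ≤ O.toSubring → ∀ F : Finset R, HasShadow O R F

/-! ## The binder form and the registered stub -/

/-- **Shadows for a Hensel-generated top layer over a ruled skeleton, rational rank one** (binder
form of the registered stub `stub_henselOverRuledShadowsRankOne`; conclusion `HasShadow O R F`):
for `k` algebraically closed of characteristic `p`, `K/k` finitely generated, `O ∋ k` rational of
rational rank one, `ν|K₀` discrete, `v` transcendental over `K₀`, `η ∈ O` a Hensel root over
`O ∩ K₀(v)` and `K = K₀(v, η)`, every finitely generated `R ⊆ O` and finite `F ⊆ R` admit a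
shadow exact on `F` — `henselOverRuledShadowsRankOne_of` with `M = K̄`. [folklore] -/
theorem henselOverRuledShadowsRankOne (p : ℕ) (hp : p.Prime) (k K : Type) [Field k] [CharP k p]
    [IsAlgClosed k] [Field K] [Algebra k K] (hfg : (⊤ : IntermediateField k K).FG)
    (O : ValuationSubring K) (hk : ∀ c : k, algebraMap k K c ∈ O)
    (hrat : ∀ x : K, x ∈ O → ∃ c : k, O.valuation (x - algebraMap k K c) < 1)
    (hr : Module.finrank ℤ (Additive (O.ValueGroup)ˣ) = 1) (K₀ : IntermediateField k K)
    (t v η : K) (h : Polynomial K) (htK₀ : t ∈ K₀) (ht0 : t ≠ 0) (ht1 : O.valuation t < 1)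
    (hdisc : ∀ x : K, x ∈ K₀ → x ≠ 0 → ∃ m : ℤ, O.valuation x = O.valuation t ^ m)
    (hv : Transcendental K₀ v)
    (hcoef : ∀ i : ℕ, h.coeff i ∈ IntermediateField.adjoin K₀ {v} ∧ h.coeff i ∈ O)
    (hmon : h.Monic) (hroot : Polynomial.aeval η h = 0)
    (hder : O.valuation (Polynomial.aeval η (Polynomial.derivative h)) = 1) (hηO : η ∈ O)
    (hgen : IntermediateField.adjoin K₀ {v, η} = ⊤) (R : Subalgebra k K) (hR : R.FG)
    (hRO : R.toSubring ≤ O.toSubring) (F : Finset R) : HasShadow O R F := by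
  -- `p`, `hp` are part of the registered signature (the crux's standing hypotheses); the
  -- construction does not use the characteristic.
  have _hp := hp
  exact henselOverRuledShadowsRankOne_of k K hfg O hk hrat hr K₀ t v η h htK₀ ht0 ht1 hdisc hv
    hcoef hmon hroot hder hηO hgen R hR hRO F (AlgebraicClosure K)

/-- **STUB `stub_henselOverRuledShadowsRankOne` of line `birth` of crux `SemivaluationShadows`,
PROVED** (registered signature `Sig.stub_henselOverRuledShadowsRankOne`, by name; it unfolds to
the skeleton's statement verbatim): shadows for Hensel-generated top layers over a ruled
skeleton in rational rank one — `henselOverRuledShadowsRankOne`. [folklore] -/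
theorem stub_henselOverRuledShadowsRankOne : Sig.stub_henselOverRuledShadowsRankOne :=
  fun p hp k K _ _ _ _ _ => henselOverRuledShadowsRankOne p hp k K

end Summit.ResolutionOfSingularities.ResolutionOfSingularities.Theorems

end
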